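import Mathlib.Topology.Baire.Lemmas
import Mathlib.Topology.Baire.LocallyCompactRegular
import Literature.IUT.HodgeTheaters.ProfiniteCompletionCommensurablyTerminal
import Literature.IUT.HodgeTheaters.TemperedCoveringsFreeModelLevelData
import HarnessLib

/-!
# The free-group toy as a model of [IUTchI] Prop. 2.1 / 2.2 / 2.4: the model boundary

Mochizuki, *Inter-universal Teichmüller theory I: construction of Hodge theaters*, kurims manuscript
(May 2020), §2, Proposition 2.1, Proposition 2.2 p. 45, Proposition 2.4 p. 50
[cite: Mochizuki2012, Prop 2.1 p.45; Prop 2.2 p.45; Prop 2.4 p.50] (D-0012 claim key; nothing of the series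
is asserted here).

PROOF-ONLY sequel of `ProfiniteCompletionCommensurablyTerminal.lean` (abc-iut cell, seat abc-iut-w4-d055;
director-abc (C3) «FACT-LIST proving», rows F-2589 / F-2590 of plan/FACT-LIST.md), completing the
table of the six §2 tempered-covering predicates at abc-iut-L5-d4's consistency datum
`StableCurveTemperedData.FreeModel.toy` (`Π^tp = Δ^tp = F₂` discrete ↪ `Π̂ = Δ̂ = F̂₂`, `G_k = 1`,
`Π^tp_ℍ = ⟨x₀⟩`, `Π̂_ℍ =` its closure):

* `not_graph_tpH_in_hat` — **MODEL BOUNDARY**: the clause "`Π^tp_ℍ` is commensurably terminal in `Π̂_𝔾`"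
  of Prop. 2.2 FAILS at the toy: `Π̂_ℍ = closure ι⟨x₀⟩` is abelian (closure of an abelian subgroup), so it
  centralises — hence commensurates — `ι⟨x₀⟩`, and it is strictly bigger: were `Π̂_ℍ ⊆ ι(F₂)`, M. Hall's
  theorem (`FreeModel.hatH_inter_range`) would make the compact group `Π̂_ℍ` countably infinite, but a
  countable compact Hausdorff group is finite (Baire; `finite_of_compactSpace_of_countable`).  Hence
  `not_graph_commensuratorsOfDecompositionSubgroups`: the toy is NOT a model of the typed Prop. 2.2 — as
  print predicts: there `Π^tp_ℍ` contains the nonabelian profinite verticial groups of a PSC-type `𝔾`,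
  while the toy's anabelioids are trivial (it models `tp_in_hat`, `tpH_in_tp` — previous file — only);
* `graph_prop21_vacuous` — Prop. 2.1 holds VACUOUSLY at the toy's 𝔾-data (a discrete torsion-free `Π^tp`
  has no nontrivial compact subgroup, abc-iut-w4-d063's `FreeModel.eq_bot_of_isCompact`; the 𝔛-level twin
  Prop. 2.4 (i) is the tree's `FreeModel.prop24i_model`, `TemperedCoveringsFreeModelProp24Tower.lean`); recorded as such, for the model table only.

Model table at `FreeModel.toy` after both files: Prop 2.1 ✓(vacuous) · Prop 2.2: `tp_in_hat` ✓, `tpH_in_tp` ✓,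
`tpH_in_hat` ✗, `hatH` open · Rmk 2.2.2 content ✓ (typed form vacuous, `Σ̂ = {3}`) · Prop 2.4 (i) ✓(vacuous,
`FreeModel.prop24i_model`), (ii) ✓ (`FreeModel.prop24ii`), (iii) ✓ (`FreeModel.toy_prop24iii`).  A model instance is
not the genuine 𝔛-datum of p. 46; no definition; nothing here bears on [IUTchIII] Cor. 3.12; instantiated ≠
endorsed; typed ≠ proved.
-/

namespace Literature.IUT.HodgeTheaters

open scoped Pointwise
open Literature.AnabelianGeometry.AbsoluteAnabelian (IsCommensurablyTerminal IsNormallyTerminal)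

namespace StableCurveTemperedData

namespace FreeModel

/-! ### A countable compact Hausdorff group is finite -/

/-- **A countable compact Hausdorff topological group is finite** (Baire: some singleton is open, so the
group is discrete, and a compact discrete space is finite). [folklore] -/
private theorem finite_of_compactSpace_of_countable (G : Type*) [Group G] [TopologicalSpace G]
    [IsTopologicalGroup G] [CompactSpace G] [T2Space G] [Countable G] : Finite G := by
  obtain ⟨g, hg⟩ := nonempty_interior_of_iUnion_of_closed (X := G) (f := fun g : G => ({g} : Set G))
    (fun _ => isClosed_singleton) (Set.iUnion_of_singleton G)
  have hopen : IsOpen ({g} : Set G) := by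
    obtain ⟨x, hx⟩ := hg
    have hxg : x = g := interior_subset (s := ({g} : Set G)) hx
    subst hxg
    have hsub : interior ({x} : Set G) = {x} :=
      Set.Subset.antisymm interior_subset (Set.singleton_subset_iff.mpr hx)
    rw [← hsub]; exact isOpen_interior
  have hone : IsOpen ({1} : Set G) := by
    have himg : (Homeomorph.mulLeft g⁻¹) '' ({g} : Set G) = {1} := by
      rw [Set.image_singleton, Homeomorph.coe_mulLeft]
      simp only [inv_mul_cancel]
    rw [← himg]; exact (Homeomorph.mulLeft g⁻¹).isOpenMap _ hopen
  haveI := discreteTopology_of_isOpen_singleton_one hone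
  exact finite_of_compact_of_discrete

/-- `x₀` has infinite order in `F₂` (torsion-freeness of free groups). [folklore] -/
private theorem not_isOfFinOrder_x0 : ¬ IsOfFinOrder x0 := by
  haveI : IsMulTorsionFree F2 := inferInstanceAs (IsMulTorsionFree (FreeGroup (Fin 2)))
  exact not_isOfFinOrder_of_isMulTorsionFree (FreeGroup.of_ne_one (0 : Fin 2))

/-- `Π̂_ℍ = closure ι⟨x₀⟩` is NOT contained in the image of `F₂`: otherwise, by M. Hall
(`hatH_inter_range`), it would equal the countably infinite group `ι⟨x₀⟩` and be a countable compact
Hausdorff group, hence finite. [claim: Mochizuki2012, status: disputed] -/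
private theorem exists_mem_hatH_not_mem_range : ∃ γ : Hat, γ ∈ toy.graph.HatH ∧ γ ∉ toy.graph.ι.range := by
  by_contra h
  push Not at h
  -- then `Π̂_ℍ = ι(Π^tp_ℍ)` as sets
  have heq : (toy.graph.HatH : Set toy.graph.Hat) = toy.graph.ι '' toy.graph.TpH := by
    rw [← hatH_inter_range]
    exact (Set.inter_eq_left.mpr fun γ hγ => h γ hγ).symm
  -- `↥Π̂_ℍ` is a compact Hausdorff topological group …
  haveI : CompactSpace toy.graph.HatH :=
    isCompact_iff_compactSpace.mp (Subgroup.isClosed_topologicalClosure _).isCompact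
  -- … and countable (image of the countable `⟨x₀⟩ = range (x₀ ^ ·)`)
  have hcount : (toy.graph.HatH : Set toy.graph.Hat).Countable := by
    rw [heq]
    refine Set.Countable.image ?_ _
    change ((Subgroup.closure {x0} : Subgroup F2) : Set F2).Countable
    rw [← Subgroup.zpowers_eq_closure, Subgroup.coe_zpowers]
    exact Set.countable_range _
  haveI : Countable toy.graph.HatH := hcount.to_subtype
  haveI : Finite toy.graph.HatH := finite_of_compactSpace_of_countable toy.graph.HatH
  -- but it contains the infinite set `ι⟨x₀⟩`
  have hinf : (toy.graph.ι '' (toy.graph.TpH : Set toy.graph.Tp)).Infinite := by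
    refine Set.Infinite.image ι_injective.injOn ?_
    change ((Subgroup.closure {x0} : Subgroup F2) : Set F2).Infinite
    rw [← Subgroup.zpowers_eq_closure]
    exact infinite_zpowers.mpr not_isOfFinOrder_x0
  rw [← heq] at hinf
  exact hinf (Set.toFinite _)

/-- `Π̂_ℍ = closure ι⟨x₀⟩` is abelian (closure of an abelian subgroup in the Hausdorff group `F̂₂`).
[claim: Mochizuki2012, status: disputed] -/
private theorem hatH_comm (a b : Hat) (ha : a ∈ toy.graph.HatH) (hb : b ∈ toy.graph.HatH) :
    a * b = b * a := by
  have hs : ∀ x y : ↥(TpH.map ι), x * y = y * x := by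
    rintro ⟨_, ⟨u, hu, rfl⟩⟩ ⟨_, ⟨v, hv, rfl⟩⟩
    apply Subtype.ext
    change ι u * ι v = ι v * ι u
    have hT : TpH = Subgroup.zpowers x0 := by
      change Subgroup.closure {x0} = _
      rw [Subgroup.zpowers_eq_closure]
    rw [hT] at hu hv
    obtain ⟨i, rfl⟩ := Subgroup.mem_zpowers_iff.mp hu
    obtain ⟨j, rfl⟩ := Subgroup.mem_zpowers_iff.mp hv
    rw [← map_mul, ← map_mul, ← zpow_add, ← zpow_add, add_comm]
  letI := (TpH.map ι).commGroupTopologicalClosure hs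
  have := mul_comm (⟨a, ha⟩ : ↥(TpH.map ι).topologicalClosure) ⟨b, hb⟩
  exact congrArg Subtype.val this

/-- **MODEL BOUNDARY — clause `tpH_in_hat` of Prop. 2.2 FAILS at the free toy**: `ι(Π^tp_ℍ) = ι⟨x₀⟩ ≅ ℤ`
is NOT commensurably terminal in `Π̂_𝔾 = F̂₂` — its closure `Π̂_ℍ ≅ Ẑ·x₀` is abelian, so centralises (hence
commensurates) it, and is strictly bigger (`exists_mem_hatH_not_mem_range`).  Consistent with print: there
`Π^tp_ℍ` contains the nonabelian profinite verticial groups of a PSC-type `𝔾`; the toy's anabelioids are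
trivial, so it models `tp_in_hat`/`tpH_in_tp` but not this clause. [cite: Mochizuki2012, Prop 2.2 p.45] -/
theorem not_graph_tpH_in_hat : ¬ IsCommensurablyTerminal (toy.graph.TpH.map toy.graph.ι) := by
  intro h
  obtain ⟨γ, hγH, hγr⟩ := exists_mem_hatH_not_mem_range
  -- `γ` centralises `ι(Π^tp_ℍ)`, hence normalises it, hence commensurates it
  have hfix : ConjAct.toConjAct γ • toy.graph.TpH.map toy.graph.ι = toy.graph.TpH.map toy.graph.ι := by
    ext y
    rw [Subgroup.mem_pointwise_smul_iff_inv_smul_mem, ← map_inv, ConjAct.smul_def,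
      ConjAct.ofConjAct_toConjAct, inv_inv]
    constructor
    · intro hy
      have hy' : γ⁻¹ * y * γ ∈ toy.graph.HatH := Subgroup.le_topologicalClosure _ hy
      have hyH : y ∈ toy.graph.HatH := by
        have := toy.graph.HatH.mul_mem (toy.graph.HatH.mul_mem hγH hy') (toy.graph.HatH.inv_mem hγH)
        simpa only [mul_assoc, mul_inv_cancel, mul_one, ← mul_assoc γ γ⁻¹, mul_inv_cancel, one_mul]
          using this
      have hc := hatH_comm γ⁻¹ y (toy.graph.HatH.inv_mem hγH) hyH
      rwa [hc, mul_assoc, inv_mul_cancel, mul_one] at hy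
    · intro hy
      have hyH : y ∈ toy.graph.HatH := Subgroup.le_topologicalClosure _ hy
      have hc := hatH_comm γ⁻¹ y (toy.graph.HatH.inv_mem hγH) hyH
      rw [hc, mul_assoc, inv_mul_cancel, mul_one]
      exact hy
  have hγC : γ ∈ Subgroup.Commensurable.commensurator (toy.graph.TpH.map toy.graph.ι) := by
    rw [Subgroup.Commensurable.commensurator_mem_iff, hfix]
  rw [h.commensurator_eq] at hγC
  -- so `γ ∈ ι(Π^tp_ℍ) ⊆ ι(F₂)`, contradiction
  obtain ⟨t, -, rfl⟩ := hγC
  exact hγr ⟨t, rfl⟩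

/-- Hence **the free toy is NOT a model of the typed Prop. 2.2** (`CommensuratorsOfDecompositionSubgroups`):
the clause `tpH_in_hat` fails there (FACT-LIST F-2590: schema; PROVED-AT-MODEL for `tp_in_hat`,
`tpH_in_tp` only). [cite: Mochizuki2012, Prop 2.2 p.45] -/
theorem not_graph_commensuratorsOfDecompositionSubgroups :
    ¬ toy.graph.CommensuratorsOfDecompositionSubgroups :=
  fun h => not_graph_tpH_in_hat h.tpH_in_hat

/-- **Prop. 2.1 (`ProfiniteConjugatesOfCompactSubgroups`, FACT-LIST F-2589) holds VACUOUSLY at the toy**: the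
discrete torsion-free `Π^tp_𝔾 = F₂` has no nontrivial compact subgroup (abc-iut-w4-d063's
`eq_bot_of_isCompact`).  Vacuous — recorded only to complete the model table; not evidence about print.
[cite: Mochizuki2012, Prop 2.1 p.45] -/
theorem graph_prop21_vacuous : toy.graph.ProfiniteConjugatesOfCompactSubgroups :=
  ⟨fun Λ hΛ hne _ _ => (hne (eq_bot_of_isCompact Λ hΛ)).elim⟩

end FreeModel

end StableCurveTemperedData

end Literature.IUT.HodgeTheaters
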